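import Mathlib
import HarnessLib
import Summits.Ventures.LatticeQCDFlow.Exactness.PTBCHeatBathErgodic
import Summits.Ventures.LatticeQCDFlow.Exactness.InvolutiveMetropolis
import Summits.Ventures.LatticeQCDFlow.Exactness.StdGaussianRadial

/-!
# The PTBC swap lifted to the replica product is exact for the product of the tempered laws: the full PTBC cycle is uniformly ergodic

HONEST FRAMING: exact (Metropolis-corrected) sampling algorithms for lattice gauge theory;
figures of merit are autocorrelation/cost numbers at stated couplings and volumes; no
continuum-physics claim.

Venture `LatticeQCDFlow` (cell pub-lqcd), topic `Exactness`, FANOUT row 9 (eng-latcore, the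
engine `latflow.core.ptbc`: swap of the configurations of replicas `r`, `s` accepted with
`min {1, e^{−ΔS}}`, `ΔS = S_r[U_s] + S_s[U_r] − S_r[U_r] − S_s[U_s]`).  NEW WORK of the cell over the
tree (`InvolutiveMetropolis.lean`: `involMH`, `involMH_invariant` — the deterministic-involution
Metropolis kernel is exact for `e^{−H} vol` when the involution preserves `vol`; `PTBCSwap.lean`
types the swap on `Ω × Ω`, this file on the `R`-fold product; `PTBCHeatBathErgodic.lean`:
`ptbcTarget`, `ptbc_heatBath_uniformlyErgodic`; `StdGaussianRadial.lean`: `pi_withDensity`,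
`⊗(f_q μ) = (∏ f_q) ⊗μ`).  Nothing here is cited as a fact.  Printed counterparts,
NAMED ONLY: Hasenbusch PRD 96 (2017) 054504; Bonanno–Bonati–D'Elia JHEP 03 (2021) 111.

* §1 `replicaSwapMap r s U = U ∘ swap r s` (measurable, involutive) and
  **`measurePreserving_replicaSwapMap`** — exchanging two replicas preserves `⊗_q ν` (equal factors).
* §2 `ptbcEnergy S U = Σ_q S q (U q)`, the lifted swap **`ptbcSwap S r s = involMH (· ∘ swap r s) (ptbcEnergy S)`**
  (acceptance `min {1, e^{H(U) − H(U ∘ swap)}} = min {1, e^{−ΔS_rs}}`: the other replicas cancel —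
  `ptbcEnergy_sub_swap`); `ptbcSwap_invariant_withDensity` (exact for `e^{−Σ_q S_q(U_q)} ⊗ν`);
  `ptbcDensity S q = e^{−S q}`; **`ptbcTarget_eq_smul_withDensity`** (`⊗_q Z_q⁻¹e^{−S_q}·⊗μ =
  (∏ Z_q⁻¹) • e^{−H} · ⊗(⊗μ)`); **`ptbcSwap_invariant_ptbcTarget`**; `ptbcSwaps S P` (a cycle of
  swaps along a list of pairs): Markov, exact for the target.
* §3 **`ptbc_uniformlyErgodic`** — FULL PTBC: heat-bath in-replica scans for the bounded measurable
  actions `a ≤ S q ≤ b`, then any list of replica swaps: `|μ₀ Cᵗ(A) − ptbcTarget(A)| ≤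
  (1 − ((e^{a−b})^{|l|})^{|L|})ᵗ` from EVERY initial law; **`ptbcTarget_unique_invariant_swaps`** — the
  product of the tempered Gibbs laws is the ONLY invariant probability law.

NOT CLAIMED: the translation move of the periodic replica (an exact deterministic move: add it as one
more factor of `η` via `invariant_pi_replicaLift` + `PTBCSwap.measurePreserving_withDensity_of_actionInvariant`);
the identification of `S q` with the defect-weighted Wilson action at coupling `c(q)` (any bounded
measurable family is covered); swap acceptance / round-trip statistics; rates.
-/

noncomputable section

namespace Summit.Ventures.LatticeQCDFlow.Exactness

open MeasureTheory ProbabilityTheory Set Function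
open scoped ENNReal

/-! ## §1 Exchanging two replicas preserves the product reference measure -/

section Swap

variable {R : Type*} [DecidableEq R] {Ω : Type*} [MeasurableSpace Ω]

/-- Exchange the configurations of replicas `r` and `s`. -/
def replicaSwapMap (r s : R) (U : R → Ω) : R → Ω := U ∘ Equiv.swap r s

/-- The exchange is measurable. -/
theorem measurable_replicaSwapMap (r s : R) : Measurable (replicaSwapMap (Ω := Ω) r s) :=
  measurable_pi_lambda _ fun _ => measurable_pi_apply _

omit [MeasurableSpace Ω] in
/-- The exchange is an involution. -/
theorem replicaSwapMap_involutive (r s : R) : Function.Involutive (replicaSwapMap (Ω := Ω) r s) := by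
  intro U
  funext q
  simp only [replicaSwapMap, comp_apply, Equiv.swap_apply_self]

variable [Fintype R]

/-- **Exchanging two replicas preserves the product of equal reference measures.** -/
theorem measurePreserving_replicaSwapMap (r s : R) (ν : Measure Ω) [SigmaFinite ν] :
    MeasurePreserving (replicaSwapMap r s) (Measure.pi fun _ : R => ν) (Measure.pi fun _ : R => ν) := by
  refine ⟨measurable_replicaSwapMap r s, (Measure.pi_eq fun t ht => ?_).symm⟩
  rw [Measure.map_apply (measurable_replicaSwapMap r s) (MeasurableSet.univ_pi ht)]
  have hpre : replicaSwapMap r s ⁻¹' Set.pi univ t = Set.pi univ fun q => t (Equiv.swap r s q) := by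
    ext U
    simp only [mem_preimage, mem_univ_pi, replicaSwapMap, comp_apply]
    constructor
    · intro h q
      have h' := h (Equiv.swap r s q)
      rwa [Equiv.swap_apply_self] at h'
    · intro h q
      have h' := h (Equiv.swap r s q)
      rwa [Equiv.swap_apply_self] at h'
  rw [hpre, Measure.pi_pi]
  exact Fintype.prod_equiv (Equiv.swap r s) _ _ fun q => rfl

end Swap

/-! ## §2 The lifted swap kernel and its exactness for the product target -/

section Lifted

variable {R : Type*} [DecidableEq R] [Fintype R] {Ω : Type*} [MeasurableSpace Ω] (S : R → Ω → ℝ)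

/-- The total tempered energy `H(U) = Σ_q S_q(U_q)`. -/
def ptbcEnergy (U : R → Ω) : ℝ := ∑ q, S q (U q)

/-- The tempered Boltzmann densities `e^{−S_q}`. -/
def ptbcDensity (q : R) (ω : Ω) : ℝ≥0∞ := ENNReal.ofReal (Real.exp (-S q ω))

/-- **THE LIFTED PTBC SWAP** of replicas `r`, `s`: propose `U ↦ U ∘ swap r s`, accept with
`min {1, e^{H(U) − H(U ∘ swap r s)}}`. -/
def ptbcSwap (r s : R) : Kernel (R → Ω) (R → Ω) :=
  involMH (replicaSwapMap r s) (measurable_replicaSwapMap r s) (ptbcEnergy S)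

/-- A cycle of swaps along a list of replica pairs. -/
def ptbcSwaps (P : List (R × R)) : Kernel (R → Ω) (R → Ω) :=
  cycle (P.map fun rs => ptbcSwap S rs.1 rs.2)

variable {S}

omit [DecidableEq R] in
/-- The total energy is measurable. -/
theorem measurable_ptbcEnergy (hS : ∀ q, Measurable (S q)) : Measurable (ptbcEnergy S) :=
  Finset.measurable_sum _ fun q _ => (hS q).comp (measurable_pi_apply q)

omit [DecidableEq R] [Fintype R] in
/-- The densities are measurable. -/
theorem measurable_ptbcDensity (hS : ∀ q, Measurable (S q)) (q : R) : Measurable (ptbcDensity S q) :=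
  (Real.measurable_exp.comp (hS q).neg).ennreal_ofReal

omit [DecidableEq R] [Fintype R] [MeasurableSpace Ω] in
/-- Bounded actions give pinched densities: `e^{−b} ≤ e^{−S_q} ≤ e^{−a}`. -/
theorem ptbcDensity_pinched {a b : ℝ} (hab : ∀ q ω, a ≤ S q ω ∧ S q ω ≤ b) (q : R) (ω : Ω) :
    ENNReal.ofReal (Real.exp (-b)) ≤ ptbcDensity S q ω ∧ ptbcDensity S q ω ≤ ENNReal.ofReal (Real.exp (-a)) :=
  ⟨ENNReal.ofReal_le_ofReal (Real.exp_le_exp.2 (neg_le_neg (hab q ω).2)),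
    ENNReal.ofReal_le_ofReal (Real.exp_le_exp.2 (neg_le_neg (hab q ω).1))⟩

omit [MeasurableSpace Ω] in
/-- **The energy change of a swap involves the two replicas only**:
`H(U) − H(U ∘ swap r s) = S_r U_r + S_s U_s − S_r U_s − S_s U_r` (`r ≠ s`). -/
theorem ptbcEnergy_sub_swap {r s : R} (hrs : r ≠ s) (U : R → Ω) :
    ptbcEnergy S U - ptbcEnergy S (replicaSwapMap r s U) = S r (U r) + S s (U s) - S r (U s) - S s (U r) := by
  unfold ptbcEnergy replicaSwapMap
  rw [← Finset.sum_sub_distrib, ← Finset.sum_subset (Finset.subset_univ {r, s})]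
  · rw [Finset.sum_pair hrs]
    simp only [comp_apply, Equiv.swap_apply_left, Equiv.swap_apply_right]
    ring
  · intro q _ hq
    rw [Finset.mem_insert, Finset.mem_singleton, not_or] at hq
    simp only [comp_apply, Equiv.swap_apply_of_ne_of_ne hq.1 hq.2, sub_self]

/-- The lifted swap is Markov. -/
theorem isMarkovKernel_ptbcSwap (hS : ∀ q, Measurable (S q)) (r s : R) : IsMarkovKernel (ptbcSwap S r s) := by
  haveI : Fact (Measurable (ptbcEnergy S)) := ⟨measurable_ptbcEnergy hS⟩
  unfold ptbcSwap; infer_instance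

/-- A cycle of swaps is Markov. -/
theorem isMarkovKernel_ptbcSwaps (hS : ∀ q, Measurable (S q)) (P : List (R × R)) : IsMarkovKernel (ptbcSwaps S P) := by
  refine isMarkovKernel_cycle fun κ hκ => ?_
  obtain ⟨rs, -, rfl⟩ := List.mem_map.1 hκ
  exact isMarkovKernel_ptbcSwap hS rs.1 rs.2

/-- **The lifted swap is exact for `e^{−Σ_q S_q(U_q)} · ⊗_q ν`** (`involMH_invariant`: the exchange
preserves `⊗ν`). -/
theorem ptbcSwap_invariant_withDensity (hS : ∀ q, Measurable (S q)) (ν : Measure Ω) [SigmaFinite ν] (r s : R) :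
    Kernel.Invariant (ptbcSwap S r s)
      ((Measure.pi fun _ : R => ν).withDensity fun U => ENNReal.ofReal (Real.exp (-ptbcEnergy S U))) :=
  involMH_invariant (measurable_ptbcEnergy hS) (replicaSwapMap_involutive r s)
    (measurePreserving_replicaSwapMap r s ν)

omit [DecidableEq R] [MeasurableSpace Ω] in
/-- `∏_q e^{−S_q(U_q)} = e^{−H(U)}`. -/
theorem prod_ptbcDensity (U : R → Ω) : ∏ q, ptbcDensity S q (U q) = ENNReal.ofReal (Real.exp (-ptbcEnergy S U)) := by
  unfold ptbcDensity ptbcEnergy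
  rw [← ENNReal.ofReal_prod_of_nonneg fun q _ => (Real.exp_pos _).le, ← Real.exp_sum, ← Finset.sum_neg_distrib]

end Lifted

section Target

variable {R : Type*} [DecidableEq R] [Fintype R] {ι : Type*} [Fintype ι] {X : ι → Type*}
  [∀ j, MeasurableSpace (X j)] {μ : ∀ j, Measure (X j)} [∀ j, IsProbabilityMeasure (μ j)]
  {S : R → (∀ j, X j) → ℝ}

omit [DecidableEq R] in
/-- **The product of the tempered Gibbs laws is a multiple of `e^{−H} · ⊗(⊗μ)`**:
`⊗_q (Z_q⁻¹ e^{−S_q} · ⊗μ) = (∏_q Z_q⁻¹) • e^{−Σ_q S_q(U_q)} · ⊗_q ⊗μ`. -/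
theorem ptbcTarget_eq_smul_withDensity (hS : ∀ q, Measurable (S q)) {a b : ℝ} (hab : ∀ q ω, a ≤ S q ω ∧ S q ω ≤ b) :
    ptbcTarget μ (ptbcDensity S) =
      (∏ q, (∫⁻ ω, ptbcDensity S q ω ∂Measure.pi μ)⁻¹) •
        (Measure.pi fun _ : R => Measure.pi μ).withDensity fun U => ENNReal.ofReal (Real.exp (-ptbcEnergy S U)) := by
  -- each tempered law is `⊗μ` with the density `Z_q⁻¹ e^{−S_q}`
  have hgibbs : ∀ q, piGibbsLaw μ (ptbcDensity S q) =
      (Measure.pi μ).withDensity ((∫⁻ ω, ptbcDensity S q ω ∂Measure.pi μ)⁻¹ • ptbcDensity S q) := fun q => by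
    rw [withDensity_smul _ (measurable_ptbcDensity hS q), piGibbsLaw]
  haveI : ∀ q, IsProbabilityMeasure (piGibbsLaw μ (ptbcDensity S q)) := fun q =>
    isProbabilityMeasure_piGibbsLaw (μ := μ) (p := ptbcDensity S q)
      (by rw [Ne, ENNReal.ofReal_eq_zero, not_le]; exact Real.exp_pos (-b)) ENNReal.ofReal_ne_top
      (fun ω => (ptbcDensity_pinched hab q ω).1) (fun ω => (ptbcDensity_pinched hab q ω).2)
  have hprod : (fun U : R → ∀ j, X j => ∏ q, ((∫⁻ ω, ptbcDensity S q ω ∂Measure.pi μ)⁻¹ • ptbcDensity S q) (U q)) =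
      (∏ q, (∫⁻ ω, ptbcDensity S q ω ∂Measure.pi μ)⁻¹) • fun U => ENNReal.ofReal (Real.exp (-ptbcEnergy S U)) := by
    funext U
    simp only [Pi.smul_apply, smul_eq_mul, Finset.prod_mul_distrib, prod_ptbcDensity]
  have hmeas : Measurable fun U : R → ∀ j, X j => ENNReal.ofReal (Real.exp (-ptbcEnergy S U)) :=
    (Real.measurable_exp.comp (measurable_ptbcEnergy hS).neg).ennreal_ofReal
  unfold ptbcTarget
  rw [pi_withDensity (fun _ : R => Measure.pi μ) (fun q => piGibbsLaw μ (ptbcDensity S q))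
    (fun q => (measurable_ptbcDensity hS q).const_smul ((∫⁻ ω, ptbcDensity S q ω ∂Measure.pi μ)⁻¹)) hgibbs,
    hprod, withDensity_smul _ hmeas]

/-- **THE LIFTED SWAP IS EXACT FOR THE PRODUCT OF THE TEMPERED GIBBS LAWS.** -/
theorem ptbcSwap_invariant_ptbcTarget (hS : ∀ q, Measurable (S q)) {a b : ℝ}
    (hab : ∀ q ω, a ≤ S q ω ∧ S q ω ≤ b) (r s : R) :
    Kernel.Invariant (ptbcSwap S r s) (ptbcTarget μ (ptbcDensity S)) := by
  rw [ptbcTarget_eq_smul_withDensity hS hab]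
  exact invariant_smul (ptbcSwap_invariant_withDensity hS (Measure.pi μ) r s) _

/-- … and so is any cycle of swaps. -/
theorem ptbcSwaps_invariant_ptbcTarget (hS : ∀ q, Measurable (S q)) {a b : ℝ}
    (hab : ∀ q ω, a ≤ S q ω ∧ S q ω ≤ b) (P : List (R × R)) :
    Kernel.Invariant (ptbcSwaps S P) (ptbcTarget μ (ptbcDensity S)) := by
  refine invariant_cycle fun κ hκ => ?_
  obtain ⟨rs, -, rfl⟩ := List.mem_map.1 hκ
  exact ptbcSwap_invariant_ptbcTarget hS hab rs.1 rs.2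

/-! ## §3 The full PTBC cycle -/

variable [DecidableEq ι]

/-- **PTBC IS UNIFORMLY ERGODIC.**  Replicas `q : R` with bounded measurable actions `a ≤ S q ≤ b` on
the product `Π j, X j` of probability spaces; one cycle = the heat-bath scan over `l` (through every
site) on every replica of `L` (through every replica), then the swaps along any list `P` of replica
pairs: with `C = ptbcSwaps S P ∘ₖ replicaSweep (ptbcInReplica μ (e^{−S ·}) l) L` and
`ε = ((e^{−b}/e^{−a})^{|l|})^{|L|}`, `|μ₀ Cᵗ(A) − (⊗_q Z_q⁻¹e^{−S_q}·⊗μ)(A)| ≤ (1 − ε)ᵗ` for every initial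
law `μ₀`, every `t`, every `A`. -/
theorem ptbc_uniformlyErgodic (hS : ∀ q, Measurable (S q)) {a b : ℝ} (hab : ∀ q ω, a ≤ S q ω ∧ S q ω ≤ b)
    {l : List ι} (hl : ∀ j, j ∈ l) {L : List R} (hL : ∀ r, r ∈ L) (P : List (R × R))
    (μ₀ : Measure (R → ∀ j, X j)) [IsProbabilityMeasure μ₀] (t : ℕ) (A : Set (R → ∀ j, X j)) :
    |((fun ν : Measure (R → ∀ j, X j) =>
          ν.bind (ptbcSwaps S P ∘ₖ replicaSweep (ptbcInReplica μ (ptbcDensity S) l) L))^[t] μ₀).real A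
        - (ptbcTarget μ (ptbcDensity S)).real A| ≤
      (1 - (((ENNReal.ofReal (Real.exp (-b)) * (ENNReal.ofReal (Real.exp (-a)))⁻¹) ^ l.length) ^ L.length).toReal) ^ t := by
  haveI := isMarkovKernel_ptbcSwaps (S := S) hS P
  exact ptbc_heatBath_uniformlyErgodic (μ := μ) (p := ptbcDensity S) (measurable_ptbcDensity hS)
    (by rw [Ne, ENNReal.ofReal_eq_zero, not_le]; exact Real.exp_pos (-b)) ENNReal.ofReal_ne_top
    (fun q ω => (ptbcDensity_pinched hab q ω).1) (fun q ω => (ptbcDensity_pinched hab q ω).2) hl hL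
    (ptbcSwaps S P) (ptbcSwaps_invariant_ptbcTarget hS hab P) μ₀ t A

/-- **The product of the tempered Gibbs laws is the ONLY invariant probability law of the PTBC cycle.** -/
theorem ptbcTarget_unique_invariant_swaps (hS : ∀ q, Measurable (S q)) {a b : ℝ}
    (hab : ∀ q ω, a ≤ S q ω ∧ S q ω ≤ b) {l : List ι} (hl : ∀ j, j ∈ l) {L : List R} (hL : ∀ r, r ∈ L)
    (P : List (R × R)) {Q : Measure (R → ∀ j, X j)} [IsProbabilityMeasure Q]
    (hQ : Kernel.Invariant (ptbcSwaps S P ∘ₖ replicaSweep (ptbcInReplica μ (ptbcDensity S) l) L) Q) :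
    Q = ptbcTarget μ (ptbcDensity S) := by
  haveI := isMarkovKernel_ptbcSwaps (S := S) hS P
  exact ptbcTarget_unique_invariant (μ := μ) (p := ptbcDensity S) (measurable_ptbcDensity hS)
    (by rw [Ne, ENNReal.ofReal_eq_zero, not_le]; exact Real.exp_pos (-b)) ENNReal.ofReal_ne_top
    (fun q ω => (ptbcDensity_pinched hab q ω).1) (fun q ω => (ptbcDensity_pinched hab q ω).2) hl hL
    (ptbcSwaps S P) (ptbcSwaps_invariant_ptbcTarget hS hab P) hQ

end Target

end Summit.Ventures.LatticeQCDFlow.Exactness
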